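import Literature.NumberTheory.ModularForms.QuasimodularPsi
import Literature.NumberTheory.ModularForms.QuasimodularDual
import Literature.NumberTheory.EllipticCurves.ModularFormsRamanujan
import HarnessLib

/-!
# The explicit interpolation kernels `𝒦±^{(8)}`, `𝒦±^{(24)}` of CKMRV §4.4 and their functional
  equations in `τ` (Theorem 4.1 (2)) and in `z` (Proposition 4.8)

Cohn–Kumar–Miller–Radchenko–Viazovska, Ann. of Math. 196 (2022) = arXiv:1902.05438, §4.4 (4.13):
"We claim that they are given by
`𝒦₊^{(d)}(τ,z) = (φ₋₂(τ), φ₀(τ), φ₂(τ)) Υ₊^{(d)}(τ,z) (φ̃₋₂(z), φ̃₀(z), φ̃₂(z))ᵗ` and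
`𝒦₋^{(d)}(τ,z) = (ψ₀(τ), ψ₂(τ), ψ₄(τ)) Υ₋^{(d)}(τ,z) (ψ̃₀(z), ψ̃₂(z), ψ̃₄(z))ᵗ`", with
`(f₋₂, f₀, f₂, …, f₁₄) = (E₁₀/Δ, 1, E₁₄/Δ, E₄, E₆, E₈, E₁₀, Δ, E₁₄)`, `Π_{k₁,k₂,k₃} = diag(f_{kᵢ})`,
`j_{τ,z} = j(τ) − j(z)`, `𝔠 = 1728`, and the four matrices `Υ₊^{(8)}`, `Υ₊^{(24)}`, `Υ₋^{(8)}`,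
`Υ₋^{(24)}` printed there. "Theorem 4.1 can now be straightforwardly verified from these formulas …
property (2) follows from Propositions 4.2 and 4.3 and the weights of the coefficients of `φₖ` and
`ψₖ`." Proposition 4.8: "`𝒦±(τ,z)|^z_{2−d/2} r = 0` for all `r ∈ 𝓘̃±`."

This file DEFINES the four kernels `kernelPlus8`, `kernelMinus8`, `kernelPlus24`,
`kernelMinus24 : ℍ → ℍ → ℂ` by the printed formulas (with Klein's `j = E₄³/Δ` of
`ModularCurveKleinJ.lean`, Mathlib's `E₄, E₆, Δ`, `E₈ = E₄²`, `E₁₀ = E₄E₆`, `E₁₄ = E₄²E₆`; at the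
poles `j(τ) = j(z)` the value is Lean's junk `x/0 = 0`) and PROVES, identically in the other
variable:

* **Theorem 4.1 (2)**: `τ ↦ 𝒦₊^{(d)}(τ,z)` solves (4.5) (`|_{d/2}(T − I)² = 0`, `|_{d/2}(S + I) = 0`)
  and `τ ↦ 𝒦₋^{(d)}(τ,z)` solves (4.7) (`|_{d/2}(T − I)² = 0`, `|_{d/2}(S − I) = 0`)
  (`isAnnPlus_kernelPlus8`, `isAnnMinus_kernelMinus8`, `isAnnPlus_kernelPlus24`,
  `isAnnMinus_kernelMinus24`);
* **Proposition 4.8**: `z ↦ 𝒦±^{(d)}(τ,z)` solves (4.9), resp. (4.11), in weight `2 − d/2`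
  (`isAnnPlusDual_kernelPlus8`, …).

Because `j` is `SL₂(ℤ)`-invariant, the junk convention is compatible with the slash actions and
the equations hold at every point. Parts (1), (3), (4) of Theorem 4.1 (poles, residues, growth)
are not treated here.

## References

* H. Cohn, A. Kumar, S. D. Miller, D. Radchenko, M. Viazovska, Ann. of Math. 196 (2022),
  arXiv:1902.05438, §4.4 (4.13) and the displays defining `Υ±^{(d)}`; Theorem 4.1 (2);
  Proposition 4.8. [CohnEtAl2019]
-/

noncomputable section

open Complex hiding I
open Filter Topology ModularForm SlashInvariantForm EisensteinSeries
open UpperHalfPlane hiding I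
open Complex (I)
open scoped Real MatrixGroups ModularForm Manifold

namespace Literature.NumberTheory.ModularForms

open Literature.NumberTheory.EllipticCurves.ModularForms (kleinJ kleinJ_smul levelOne_apply_smul
  discriminant_apply_smul)

/-! ## Level-one invariance as plain functions -/

/-- `f` is invariant under the weight-`k` action of `SL₂(ℤ)` (as a function on `ℍ`, no holomorphy
or growth condition). [folklore] -/
def IsLevelOneInvariant (k : ℤ) (f : ℍ → ℂ) : Prop := ∀ γ : SL(2, ℤ), f ∣[k] γ = f

namespace IsLevelOneInvariant

variable {k k' : ℤ} {f g : ℍ → ℂ}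

/-- Pointwise form. [folklore] -/
theorem apply_smul (hf : IsLevelOneInvariant k f) (γ : SL(2, ℤ)) (τ : ℍ) :
    f (γ • τ) = denom (γ : GL (Fin 2) ℝ) τ ^ k * f τ := by
  have h := congrFun (hf γ) τ
  rw [SL_slash_apply] at h
  have hd : denom (γ : GL (Fin 2) ℝ) τ ≠ 0 := denom_ne_zero _ _
  rw [← h, mul_left_comm, ← zpow_add₀ hd, add_neg_cancel, zpow_zero, mul_one]

/-- Constructor from the pointwise law. [folklore] -/
theorem of_apply_smul (h : ∀ (γ : SL(2, ℤ)) (τ : ℍ), f (γ • τ) = denom (γ : GL (Fin 2) ℝ) τ ^ k * f τ) :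
    IsLevelOneInvariant k f := fun γ => by
  funext τ
  have hd : denom (γ : GL (Fin 2) ℝ) τ ≠ 0 := denom_ne_zero _ _
  rw [SL_slash_apply, h, mul_comm, ← mul_assoc, ← zpow_add₀ hd, neg_add_cancel, zpow_zero, one_mul]

/-- Invariance under `T`. [folklore] -/
theorem T (hf : IsLevelOneInvariant k f) : f ∣[k] ModularGroup.T = f := hf _
/-- Invariance under `S`. [folklore] -/
theorem S (hf : IsLevelOneInvariant k f) : f ∣[k] ModularGroup.S = f := hf _

/-- Products. [folklore] -/
theorem mul (hf : IsLevelOneInvariant k f) (hg : IsLevelOneInvariant k' g) :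
    IsLevelOneInvariant (k + k') (f * g) := fun γ => by rw [mul_slash_SL2, hf γ, hg γ]

/-- Scalar multiples. [folklore] -/
theorem smul (hf : IsLevelOneInvariant k f) (c : ℂ) : IsLevelOneInvariant k (c • f) := fun γ => by
  rw [SL_smul_slash, hf γ]

/-- Sums. [folklore] -/
theorem add (hf : IsLevelOneInvariant k f) (hg : IsLevelOneInvariant k g) :
    IsLevelOneInvariant k (f + g) := fun γ => by rw [SlashAction.add_slash, hf γ, hg γ]

/-- Inverses of invariant functions (with Lean's `0⁻¹ = 0`). [folklore] -/
theorem inv (hf : IsLevelOneInvariant k f) : IsLevelOneInvariant (-k) f⁻¹ :=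
  of_apply_smul fun γ τ => by
    rw [Pi.inv_apply, Pi.inv_apply, hf.apply_smul, mul_inv, ← zpow_neg]

/-- Casting the weight. [folklore] -/
theorem cast (hf : IsLevelOneInvariant k f) (h : k = k') : IsLevelOneInvariant k' f := h ▸ hf

/-- Constants (weight `0`). [folklore] -/
theorem const (c : ℂ) : IsLevelOneInvariant 0 fun _ : ℍ => c :=
  of_apply_smul fun γ τ => by rw [zpow_zero, one_mul]

/-- `SL₂(ℤ)`-invariant scalar functions (weight `0`), e.g. functions of `j`. [folklore] -/
theorem of_smul_eq (h : ∀ (γ : SL(2, ℤ)) (τ : ℍ), f (γ • τ) = f τ) : IsLevelOneInvariant 0 f :=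
  of_apply_smul fun γ τ => by rw [h, zpow_zero, one_mul]

/-- Level-one modular forms. [folklore] -/
theorem of_modularForm (F : ModularForm 𝒮ℒ k) : IsLevelOneInvariant k ⇑F := fun γ =>
  F.slash_action_eq' _ ⟨γ, rfl⟩

end IsLevelOneInvariant

/-- `Δ` is invariant of weight `12`. [folklore] -/
theorem isLevelOneInvariant_discriminant : IsLevelOneInvariant 12 ModularForm.discriminant :=
  IsLevelOneInvariant.of_apply_smul fun γ τ => discriminant_apply_smul γ τ

/-- `E₄` (weight `4`). [folklore] -/
theorem isLevelOneInvariant_E₄ : IsLevelOneInvariant 4 ⇑E₄ := IsLevelOneInvariant.of_modularForm _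
/-- `E₆` (weight `6`). [folklore] -/
theorem isLevelOneInvariant_E₆ : IsLevelOneInvariant 6 ⇑E₆ := IsLevelOneInvariant.of_modularForm _

/-- Functions of `j(τ)` are invariant of weight `0`. [folklore] -/
theorem isLevelOneInvariant_comp_kleinJ (h : ℂ → ℂ) : IsLevelOneInvariant 0 fun τ => h (kleinJ τ) :=
  IsLevelOneInvariant.of_smul_eq fun γ τ => by rw [kleinJ_smul]

/-! ## The level-one pieces `E₈, E₁₀, E₁₄` and the `fₖ` -/

/-- `E₈ = E₄²`. [cite: CohnEtAl2019, §4.4] -/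
def E8fun : ℍ → ℂ := ⇑E₄ * ⇑E₄
/-- `E₁₀ = E₄E₆`. [cite: CohnEtAl2019, §4.4] -/
def E10fun : ℍ → ℂ := ⇑E₄ * ⇑E₆
/-- `E₁₄ = E₄²E₆`. [cite: CohnEtAl2019, §4.4] -/
def E14fun : ℍ → ℂ := ⇑E₄ * ⇑E₄ * ⇑E₆

/-- `f₂ = E₁₄/Δ`. [cite: CohnEtAl2019, §4.4] -/
def f2fun : ℍ → ℂ := E14fun * ModularForm.discriminant⁻¹
/-- `f₋₂ = E₁₀/Δ`. [cite: CohnEtAl2019, §4.4] -/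
def fNeg2fun : ℍ → ℂ := E10fun * ModularForm.discriminant⁻¹

/-- `E₈` (weight `8`). [folklore] -/
theorem isLevelOneInvariant_E8 : IsLevelOneInvariant 8 E8fun :=
  (isLevelOneInvariant_E₄.mul isLevelOneInvariant_E₄).cast (by norm_num)
/-- `E₁₀` (weight `10`). [folklore] -/
theorem isLevelOneInvariant_E10 : IsLevelOneInvariant 10 E10fun :=
  (isLevelOneInvariant_E₄.mul isLevelOneInvariant_E₆).cast (by norm_num)
/-- `E₁₄` (weight `14`). [folklore] -/
theorem isLevelOneInvariant_E14 : IsLevelOneInvariant 14 E14fun :=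
  ((isLevelOneInvariant_E₄.mul isLevelOneInvariant_E₄).mul isLevelOneInvariant_E₆).cast (by norm_num)
/-- `Δ⁻¹` (weight `−12`). [folklore] -/
theorem isLevelOneInvariant_discriminant_inv : IsLevelOneInvariant (-12) ModularForm.discriminant⁻¹ :=
  isLevelOneInvariant_discriminant.inv
/-- `E₁₄/Δ` (weight `2`). [folklore] -/
theorem isLevelOneInvariant_f2 : IsLevelOneInvariant 2 f2fun :=
  (isLevelOneInvariant_E14.mul isLevelOneInvariant_discriminant_inv).cast (by norm_num)
/-- `E₁₀/Δ` (weight `−2`). [folklore] -/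
theorem isLevelOneInvariant_fNeg2 : IsLevelOneInvariant (-2) fNeg2fun :=
  (isLevelOneInvariant_E10.mul isLevelOneInvariant_discriminant_inv).cast (by norm_num)

/-! ## Assembly lemmas: the three-term shapes of Propositions 4.2–4.5 -/

/-- `φ₋₂a₁ + φ₀a₂ + φ₂a₃ ∈ Ann_k(𝓘₊)` for invariant `aᵢ` of weights `k + 2, k, k − 2`.
[cite: CohnEtAl2019, §4.2 Proposition 4.2] -/
theorem isAnnPlus_three {k : ℤ} {a₁ a₂ a₃ : ℍ → ℂ} (h₁ : IsLevelOneInvariant (k + 2) a₁)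
    (h₂ : IsLevelOneInvariant k a₂) (h₃ : IsLevelOneInvariant (k - 2) a₃) :
    IsAnnPlus k (phiNeg2 * a₁ + phi0 * a₂ + phi2 * a₃) :=
  ((phiNeg2_mul_isAnnPlus h₁.T h₁.S).add (phi0_mul_isAnnPlus h₂.T h₂.S)).add
    (phi2_mul_isAnnPlus h₃.T h₃.S)

/-- `a₁ + ψ₂a₂ + ψ₄a₃ ∈ Ann_k(𝓘₋)` for invariant `aᵢ` of weights `k, k − 2, k − 4` (`ψ₀ = 1`).
[cite: CohnEtAl2019, §4.2 Proposition 4.3] -/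
theorem isAnnMinus_three {k : ℤ} {a₁ a₂ a₃ : ℍ → ℂ} (h₁ : IsLevelOneInvariant k a₁)
    (h₂ : IsLevelOneInvariant (k - 2) a₂) (h₃ : IsLevelOneInvariant (k - 4) a₃) :
    IsAnnMinus k (a₁ + psi2 * a₂ + psi4 * a₃) :=
  ((isAnnMinus_of_invariant h₁.T h₁.S).add (psi2_mul_isAnnMinus h₂.T h₂.S)).add
    (psi4_mul_isAnnMinus h₃.T h₃.S)

/-- `φ̃₋₂b₁ + φ̃₀b₂ + φ̃₂b₃ ∈ Ann_k(𝓘̃₊)` for invariant `bᵢ` of weights `k + 2, k, k − 2`.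
[cite: CohnEtAl2019, §4.2 Proposition 4.4] -/
theorem isAnnPlusDual_three {k : ℤ} {b₁ b₂ b₃ : ℍ → ℂ} (h₁ : IsLevelOneInvariant (k + 2) b₁)
    (h₂ : IsLevelOneInvariant k b₂) (h₃ : IsLevelOneInvariant (k - 2) b₃) :
    IsAnnPlusDual k (phiTildeNeg2 * b₁ + phiTilde0 * b₂ + phiTilde2 * b₃) :=
  ((phiTildeNeg2_mul_isAnnPlusDual h₁.T h₁.S).add (phiTilde0_mul_isAnnPlusDual h₂.T h₂.S)).add
    (phiTilde2_mul_isAnnPlusDual h₃.T h₃.S)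

/-- `ψ̃₀b₁ + ψ̃₂b₂ + ψ̃₄b₃ ∈ Ann_k(𝓘̃₋)` for invariant `bᵢ` of weights `k, k − 2, k − 4`.
[cite: CohnEtAl2019, §4.2 Proposition 4.5] -/
theorem isAnnMinusDual_three {k : ℤ} {b₁ b₂ b₃ : ℍ → ℂ} (h₁ : IsLevelOneInvariant k b₁)
    (h₂ : IsLevelOneInvariant (k - 2) b₂) (h₃ : IsLevelOneInvariant (k - 4) b₃) :
    IsAnnMinusDual k (psiTilde0 * b₁ + psiTilde2 * b₂ + psiTilde4 * b₃) :=
  ((psiTilde0_mul_isAnnMinusDual h₁.T h₁.S).add (psiTilde2_mul_isAnnMinusDual h₂.T h₂.S)).add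
    (psiTilde4_mul_isAnnMinusDual h₃.T h₃.S)

/-! ## The kernels in dimension `8` -/

/-- **`𝒦₊^{(8)}(τ, z)`** (CKMRV (4.13) with `Υ₊^{(8)}`):
`π²/(36 i Δ(z) j_{τ,z}) · [φ₋₂(τ)E₆(τ)(j_{τ,z}Δ(z)φ̃₋₂(z) + E₈(z)φ̃₂(z))`
` + φ₀(τ)E₄(τ)(−2j_{τ,z}Δ(z)φ̃₋₂(z) − 2E₁₀(z)φ̃₀(z)) + φ₂(τ)(E₁₄/Δ)(τ)Δ(z)φ̃₋₂(z)]`,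
`j_{τ,z} = j(τ) − j(z)`. [cite: CohnEtAl2019, §4.4 (4.13)] -/
def kernelPlus8 (τ z : ℍ) : ℂ :=
  (π : ℂ) ^ 2 / (36 * I) / (ModularForm.discriminant z * (kleinJ τ - kleinJ z)) *
    (phiNeg2 τ * E₆ τ * ((kleinJ τ - kleinJ z) * ModularForm.discriminant z * phiTildeNeg2 z +
        E8fun z * phiTilde2 z) +
      phi0 τ * E₄ τ * (-2 * (kleinJ τ - kleinJ z) * ModularForm.discriminant z * phiTildeNeg2 z -
        2 * E10fun z * phiTilde0 z) +
      phi2 τ * f2fun τ * (ModularForm.discriminant z * phiTildeNeg2 z))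

/-- **`𝒦₋^{(8)}(τ, z)`** (CKMRV (4.13) with `Υ₋^{(8)}`, `𝔠 = 1728`, `ψ₀ = 1`):
`1/(2𝔠πΔ(z)j_{τ,z}) · [E₄(τ)(−2𝔠)E₁₀(z)ψ̃₀(z) + ψ₂(τ)(E₁₄/Δ)(τ)(E₈(z)ψ̃₂(z) − E₆(z)ψ̃₄(z))`
` + ψ₄(τ)((𝔠 − j(τ))E₈(z)ψ̃₂(z) + j(τ)E₆(z)ψ̃₄(z))]`. [cite: CohnEtAl2019, §4.4 (4.13)] -/
def kernelMinus8 (τ z : ℍ) : ℂ :=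
  1 / (2 * 1728 * (π : ℂ)) / (ModularForm.discriminant z * (kleinJ τ - kleinJ z)) *
    (E₄ τ * (-2 * 1728 * E10fun z * psiTilde0 z) +
      psi2 τ * f2fun τ * (E8fun z * psiTilde2 z - E₆ z * psiTilde4 z) +
      psi4 τ * ((1728 - kleinJ τ) * E8fun z * psiTilde2 z + kleinJ τ * E₆ z * psiTilde4 z))

/-- **Theorem 4.1 (2) for `𝒦₊^{(8)}` in `τ`**: for every `z`, `τ ↦ 𝒦₊^{(8)}(τ,z)` satisfies
`|₄(T − I)² = 0` and `|₄(S + I) = 0`. [cite: CohnEtAl2019, §4.4 Theorem 4.1 (2)] -/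
theorem isAnnPlus_kernelPlus8 (z : ℍ) : IsAnnPlus 4 fun τ => kernelPlus8 τ z := by
  -- the three `τ`-coefficients
  set c : ℂ := (π : ℂ) ^ 2 / (36 * I) with hc
  set a₁ : ℍ → ℂ := ⇑E₆ * fun τ => c / (ModularForm.discriminant z * (kleinJ τ - kleinJ z)) *
    ((kleinJ τ - kleinJ z) * ModularForm.discriminant z * phiTildeNeg2 z + E8fun z * phiTilde2 z) with ha₁
  set a₂ : ℍ → ℂ := ⇑E₄ * fun τ => c / (ModularForm.discriminant z * (kleinJ τ - kleinJ z)) *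
    (-2 * (kleinJ τ - kleinJ z) * ModularForm.discriminant z * phiTildeNeg2 z -
      2 * E10fun z * phiTilde0 z) with ha₂
  set a₃ : ℍ → ℂ := f2fun * fun τ => c / (ModularForm.discriminant z * (kleinJ τ - kleinJ z)) *
    (ModularForm.discriminant z * phiTildeNeg2 z) with ha₃
  have h₁ : IsLevelOneInvariant (4 + 2) a₁ :=
    (isLevelOneInvariant_E₆.mul (isLevelOneInvariant_comp_kleinJ fun j =>
      c / (ModularForm.discriminant z * (j - kleinJ z)) *
        ((j - kleinJ z) * ModularForm.discriminant z * phiTildeNeg2 z + E8fun z * phiTilde2 z))).cast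
      (by norm_num)
  have h₂ : IsLevelOneInvariant 4 a₂ :=
    (isLevelOneInvariant_E₄.mul (isLevelOneInvariant_comp_kleinJ fun j =>
      c / (ModularForm.discriminant z * (j - kleinJ z)) *
        (-2 * (j - kleinJ z) * ModularForm.discriminant z * phiTildeNeg2 z -
          2 * E10fun z * phiTilde0 z))).cast (by norm_num)
  have h₃ : IsLevelOneInvariant (4 - 2) a₃ :=
    (isLevelOneInvariant_f2.mul (isLevelOneInvariant_comp_kleinJ fun j =>
      c / (ModularForm.discriminant z * (j - kleinJ z)) *
        (ModularForm.discriminant z * phiTildeNeg2 z))).cast (by norm_num)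
  have key : (fun τ => kernelPlus8 τ z) = phiNeg2 * a₁ + phi0 * a₂ + phi2 * a₃ := by
    funext τ
    simp only [kernelPlus8, ha₁, ha₂, ha₃, hc, Pi.add_apply, Pi.mul_apply]
    ring
  rw [key]
  exact isAnnPlus_three h₁ h₂ h₃

/-- **Theorem 4.1 (2) for `𝒦₋^{(8)}` in `τ`**: `|₄(T − I)² = 0` and `|₄(S − I) = 0`.
[cite: CohnEtAl2019, §4.4 Theorem 4.1 (2)] -/
theorem isAnnMinus_kernelMinus8 (z : ℍ) : IsAnnMinus 4 fun τ => kernelMinus8 τ z := by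
  set c : ℂ := 1 / (2 * 1728 * (π : ℂ)) with hc
  set a₁ : ℍ → ℂ := ⇑E₄ * fun τ => c / (ModularForm.discriminant z * (kleinJ τ - kleinJ z)) *
    (-2 * 1728 * E10fun z * psiTilde0 z) with ha₁
  set a₂ : ℍ → ℂ := f2fun * fun τ => c / (ModularForm.discriminant z * (kleinJ τ - kleinJ z)) *
    (E8fun z * psiTilde2 z - E₆ z * psiTilde4 z) with ha₂
  set a₃ : ℍ → ℂ := fun τ => c / (ModularForm.discriminant z * (kleinJ τ - kleinJ z)) *
    ((1728 - kleinJ τ) * E8fun z * psiTilde2 z + kleinJ τ * E₆ z * psiTilde4 z) with ha₃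
  have h₁ : IsLevelOneInvariant 4 a₁ :=
    (isLevelOneInvariant_E₄.mul (isLevelOneInvariant_comp_kleinJ fun j =>
      c / (ModularForm.discriminant z * (j - kleinJ z)) * (-2 * 1728 * E10fun z * psiTilde0 z))).cast
      (by norm_num)
  have h₂ : IsLevelOneInvariant (4 - 2) a₂ :=
    (isLevelOneInvariant_f2.mul (isLevelOneInvariant_comp_kleinJ fun j =>
      c / (ModularForm.discriminant z * (j - kleinJ z)) *
        (E8fun z * psiTilde2 z - E₆ z * psiTilde4 z))).cast (by norm_num)
  have h₃ : IsLevelOneInvariant (4 - 4) a₃ :=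
    (isLevelOneInvariant_comp_kleinJ fun j => c / (ModularForm.discriminant z * (j - kleinJ z)) *
      ((1728 - j) * E8fun z * psiTilde2 z + j * E₆ z * psiTilde4 z)).cast (by norm_num)
  have key : (fun τ => kernelMinus8 τ z) = a₁ + psi2 * a₂ + psi4 * a₃ := by
    funext τ
    simp only [kernelMinus8, ha₁, ha₂, ha₃, hc, Pi.add_apply, Pi.mul_apply]
    ring
  rw [key]
  exact isAnnMinus_three h₁ h₂ h₃

/-- **Proposition 4.8 for `𝒦₊^{(8)}` in `z`**: for every `τ`, `z ↦ 𝒦₊^{(8)}(τ,z)` solves (4.9) in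
weight `2 − d/2 = −2`. [cite: CohnEtAl2019, §4.4 Proposition 4.8] -/
theorem isAnnPlusDual_kernelPlus8 (τ : ℍ) : IsAnnPlusDual (-2) fun z => kernelPlus8 τ z := by
  set c : ℂ := (π : ℂ) ^ 2 / (36 * I) with hc
  -- coefficient of `φ̃₋₂(z)`: weight `0`
  set b₁ : ℍ → ℂ := fun z => c / (kleinJ τ - kleinJ z) *
    (phiNeg2 τ * E₆ τ * (kleinJ τ - kleinJ z) + phi0 τ * E₄ τ * (-2 * (kleinJ τ - kleinJ z)) +
      phi2 τ * f2fun τ) with hb₁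
  -- coefficient of `φ̃₀(z)`: `E₁₀/Δ`, weight `−2`
  set b₂ : ℍ → ℂ := fNeg2fun * fun z => c / (kleinJ τ - kleinJ z) * (phi0 τ * E₄ τ * (-2)) with hb₂
  -- coefficient of `φ̃₂(z)`: `E₈/Δ`, weight `−4`
  set b₃ : ℍ → ℂ := (E8fun * ModularForm.discriminant⁻¹) *
    fun z => c / (kleinJ τ - kleinJ z) * (phiNeg2 τ * E₆ τ) with hb₃
  have h₁ : IsLevelOneInvariant (-2 + 2) b₁ :=
    (isLevelOneInvariant_comp_kleinJ fun j => c / (kleinJ τ - j) *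
      (phiNeg2 τ * E₆ τ * (kleinJ τ - j) + phi0 τ * E₄ τ * (-2 * (kleinJ τ - j)) + phi2 τ * f2fun τ)).cast
      (by norm_num)
  have h₂ : IsLevelOneInvariant (-2) b₂ :=
    (isLevelOneInvariant_fNeg2.mul (isLevelOneInvariant_comp_kleinJ fun j =>
      c / (kleinJ τ - j) * (phi0 τ * E₄ τ * (-2)))).cast (by norm_num)
  have h₃ : IsLevelOneInvariant (-2 - 2) b₃ :=
    ((isLevelOneInvariant_E8.mul isLevelOneInvariant_discriminant_inv).mul
      (isLevelOneInvariant_comp_kleinJ fun j => c / (kleinJ τ - j) * (phiNeg2 τ * E₆ τ))).cast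
      (by norm_num)
  have key : (fun z => kernelPlus8 τ z) = phiTildeNeg2 * b₁ + phiTilde0 * b₂ + phiTilde2 * b₃ := by
    funext z
    have hΔ : ModularForm.discriminant z ≠ 0 := ModularForm.discriminant_ne_zero z
    simp only [kernelPlus8, hb₁, hb₂, hb₃, hc, fNeg2fun, Pi.add_apply, Pi.mul_apply, Pi.inv_apply]
    field_simp
    ring
  rw [key]
  exact isAnnPlusDual_three h₁ h₂ h₃

/-- **Proposition 4.8 for `𝒦₋^{(8)}` in `z`**: `z ↦ 𝒦₋^{(8)}(τ,z)` solves (4.11) in weight `−2`.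
[cite: CohnEtAl2019, §4.4 Proposition 4.8] -/
theorem isAnnMinusDual_kernelMinus8 (τ : ℍ) : IsAnnMinusDual (-2) fun z => kernelMinus8 τ z := by
  set c : ℂ := 1 / (2 * 1728 * (π : ℂ)) with hc
  -- `ψ̃₀(z)`: `E₁₀/Δ`, weight `−2`
  set b₁ : ℍ → ℂ := fNeg2fun * fun z => c / (kleinJ τ - kleinJ z) * (E₄ τ * (-2 * 1728)) with hb₁
  -- `ψ̃₂(z)`: `E₈/Δ`, weight `−4`
  set b₂ : ℍ → ℂ := (E8fun * ModularForm.discriminant⁻¹) * fun z => c / (kleinJ τ - kleinJ z) *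
    (psi2 τ * f2fun τ + psi4 τ * (1728 - kleinJ τ)) with hb₂
  -- `ψ̃₄(z)`: `E₆/Δ`, weight `−6`
  set b₃ : ℍ → ℂ := (⇑E₆ * ModularForm.discriminant⁻¹) * fun z => c / (kleinJ τ - kleinJ z) *
    (-(psi2 τ * f2fun τ) + psi4 τ * kleinJ τ) with hb₃
  have h₁ : IsLevelOneInvariant (-2) b₁ :=
    (isLevelOneInvariant_fNeg2.mul (isLevelOneInvariant_comp_kleinJ fun j =>
      c / (kleinJ τ - j) * (E₄ τ * (-2 * 1728)))).cast (by norm_num)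
  have h₂ : IsLevelOneInvariant (-2 - 2) b₂ :=
    ((isLevelOneInvariant_E8.mul isLevelOneInvariant_discriminant_inv).mul
      (isLevelOneInvariant_comp_kleinJ fun j => c / (kleinJ τ - j) *
        (psi2 τ * f2fun τ + psi4 τ * (1728 - kleinJ τ)))).cast (by norm_num)
  have h₃ : IsLevelOneInvariant (-2 - 4) b₃ :=
    ((isLevelOneInvariant_E₆.mul isLevelOneInvariant_discriminant_inv).mul
      (isLevelOneInvariant_comp_kleinJ fun j => c / (kleinJ τ - j) *
        (-(psi2 τ * f2fun τ) + psi4 τ * kleinJ τ))).cast (by norm_num)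
  have key : (fun z => kernelMinus8 τ z) = psiTilde0 * b₁ + psiTilde2 * b₂ + psiTilde4 * b₃ := by
    funext z
    have hΔ : ModularForm.discriminant z ≠ 0 := ModularForm.discriminant_ne_zero z
    simp only [kernelMinus8, hb₁, hb₂, hb₃, hc, fNeg2fun, Pi.add_apply, Pi.mul_apply, Pi.inv_apply]
    field_simp
    ring
  rw [key]
  exact isAnnMinusDual_three h₁ h₂ h₃

/-! ## The kernels in dimension `24` -/

/-- **`𝒦₊^{(24)}(τ, z)`** (CKMRV (4.13) with `Υ₊^{(24)}`, `𝔠 = 1728`):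
`π²/(36𝔠 i Δ(z)) · [φ₋₂(τ)E₁₄(τ)(6E₄(z)φ̃₋₂(z) + (𝔠/j_{τ,z} − 6)φ̃₂(z))`
` + φ₀(τ)Δ(τ)((−12j(τ) + 5𝔠)E₄(z)φ̃₋₂(z) − (2𝔠/j_{τ,z})(E₁₄/Δ)(z)φ̃₀(z) + (12j(τ) − 7𝔠)φ̃₂(z))`
` + φ₂(τ)E₁₀(τ)((𝔠/j_{τ,z} + 6)E₄(z)φ̃₋₂(z) − 6φ̃₂(z))]`. We write it over the common
denominator `j_{τ,z}` (so that, as for the other three kernels, the value on the polar set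
`j(τ) = j(z)` is Lean's junk `0`; off the polar set this is literally the printed expression).
[cite: CohnEtAl2019, §4.4 (4.13)] -/
def kernelPlus24 (τ z : ℍ) : ℂ :=
  (π : ℂ) ^ 2 / (36 * 1728 * I) / (ModularForm.discriminant z * (kleinJ τ - kleinJ z)) *
    (phiNeg2 τ * E14fun τ *
        (6 * (kleinJ τ - kleinJ z) * E₄ z * phiTildeNeg2 z + (1728 - 6 * (kleinJ τ - kleinJ z)) * phiTilde2 z) +
      phi0 τ * ModularForm.discriminant τ *
        ((-12 * kleinJ τ + 5 * 1728) * (kleinJ τ - kleinJ z) * E₄ z * phiTildeNeg2 z -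
          2 * 1728 * f2fun z * phiTilde0 z + (12 * kleinJ τ - 7 * 1728) * (kleinJ τ - kleinJ z) * phiTilde2 z) +
      phi2 τ * E10fun τ *
        ((1728 + 6 * (kleinJ τ - kleinJ z)) * E₄ z * phiTildeNeg2 z - 6 * (kleinJ τ - kleinJ z) * phiTilde2 z))

/-- Off the polar set, `kernelPlus24` is the printed expression (overall factor `1/Δ(z)`, the
division by `j_{τ,z}` inside the matrix entries). [cite: CohnEtAl2019, §4.4 (4.13)] -/
theorem kernelPlus24_eq_printed (τ z : ℍ) (hJ : kleinJ τ ≠ kleinJ z) :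
    kernelPlus24 τ z = (π : ℂ) ^ 2 / (36 * 1728 * I) / ModularForm.discriminant z *
      (phiNeg2 τ * E14fun τ * (6 * E₄ z * phiTildeNeg2 z + (1728 / (kleinJ τ - kleinJ z) - 6) * phiTilde2 z) +
        phi0 τ * ModularForm.discriminant τ *
          ((-12 * kleinJ τ + 5 * 1728) * E₄ z * phiTildeNeg2 z -
            2 * 1728 / (kleinJ τ - kleinJ z) * f2fun z * phiTilde0 z + (12 * kleinJ τ - 7 * 1728) * phiTilde2 z) +
        phi2 τ * E10fun τ * ((1728 / (kleinJ τ - kleinJ z) + 6) * E₄ z * phiTildeNeg2 z - 6 * phiTilde2 z)) := by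
  have hJ' : kleinJ τ - kleinJ z ≠ 0 := sub_ne_zero.2 hJ
  have hΔ : ModularForm.discriminant z ≠ 0 := ModularForm.discriminant_ne_zero z
  rw [kernelPlus24]
  field_simp

/-- **`𝒦₋^{(24)}(τ, z)`** (CKMRV (4.13) with `Υ₋^{(24)}`, `𝔠 = 1728`, `ψ₀ = 1`):
`1/(2𝔠πΔ(z)j_{τ,z}) · [Δ(τ)(−2𝔠(E₁₄/Δ)(z)ψ̃₀(z) − 2𝔠 j_{τ,z}ψ̃₂(z))`
` + ψ₂(τ)E₁₀(τ)((j(τ) + 2j_{τ,z})ψ̃₂(z) − (E₁₀/Δ)(z)ψ̃₄(z))`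
` + ψ₄(τ)E₈(τ)((𝔠 − 2j_{τ,z} − j(τ))ψ̃₂(z) + (E₁₀/Δ)(z)ψ̃₄(z))]`. [cite: CohnEtAl2019, §4.4 (4.13)] -/
def kernelMinus24 (τ z : ℍ) : ℂ :=
  1 / (2 * 1728 * (π : ℂ)) / (ModularForm.discriminant z * (kleinJ τ - kleinJ z)) *
    (ModularForm.discriminant τ *
        (-2 * 1728 * f2fun z * psiTilde0 z - 2 * 1728 * (kleinJ τ - kleinJ z) * psiTilde2 z) +
      psi2 τ * E10fun τ * ((kleinJ τ + 2 * (kleinJ τ - kleinJ z)) * psiTilde2 z - fNeg2fun z * psiTilde4 z) +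
      psi4 τ * E8fun τ *
        ((1728 - 2 * (kleinJ τ - kleinJ z) - kleinJ τ) * psiTilde2 z + fNeg2fun z * psiTilde4 z))

/-- **Theorem 4.1 (2) for `𝒦₊^{(24)}` in `τ`**: `|₁₂(T − I)² = 0` and `|₁₂(S + I) = 0`.
[cite: CohnEtAl2019, §4.4 Theorem 4.1 (2)] -/
theorem isAnnPlus_kernelPlus24 (z : ℍ) : IsAnnPlus 12 fun τ => kernelPlus24 τ z := by
  set c : ℂ := (π : ℂ) ^ 2 / (36 * 1728 * I) with hc
  set a₁ : ℍ → ℂ := E14fun * fun τ => c / (ModularForm.discriminant z * (kleinJ τ - kleinJ z)) *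
    (6 * (kleinJ τ - kleinJ z) * E₄ z * phiTildeNeg2 z + (1728 - 6 * (kleinJ τ - kleinJ z)) * phiTilde2 z) with ha₁
  set a₂ : ℍ → ℂ := ModularForm.discriminant * fun τ => c / (ModularForm.discriminant z * (kleinJ τ - kleinJ z)) *
    ((-12 * kleinJ τ + 5 * 1728) * (kleinJ τ - kleinJ z) * E₄ z * phiTildeNeg2 z -
      2 * 1728 * f2fun z * phiTilde0 z + (12 * kleinJ τ - 7 * 1728) * (kleinJ τ - kleinJ z) * phiTilde2 z) with ha₂
  set a₃ : ℍ → ℂ := E10fun * fun τ => c / (ModularForm.discriminant z * (kleinJ τ - kleinJ z)) *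
    ((1728 + 6 * (kleinJ τ - kleinJ z)) * E₄ z * phiTildeNeg2 z - 6 * (kleinJ τ - kleinJ z) * phiTilde2 z) with ha₃
  have h₁ : IsLevelOneInvariant (12 + 2) a₁ :=
    (isLevelOneInvariant_E14.mul (isLevelOneInvariant_comp_kleinJ fun j =>
      c / (ModularForm.discriminant z * (j - kleinJ z)) *
        (6 * (j - kleinJ z) * E₄ z * phiTildeNeg2 z + (1728 - 6 * (j - kleinJ z)) * phiTilde2 z))).cast
      (by norm_num)
  have h₂ : IsLevelOneInvariant 12 a₂ :=
    (isLevelOneInvariant_discriminant.mul (isLevelOneInvariant_comp_kleinJ fun j =>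
      c / (ModularForm.discriminant z * (j - kleinJ z)) *
        ((-12 * j + 5 * 1728) * (j - kleinJ z) * E₄ z * phiTildeNeg2 z -
          2 * 1728 * f2fun z * phiTilde0 z + (12 * j - 7 * 1728) * (j - kleinJ z) * phiTilde2 z))).cast
      (by norm_num)
  have h₃ : IsLevelOneInvariant (12 - 2) a₃ :=
    (isLevelOneInvariant_E10.mul (isLevelOneInvariant_comp_kleinJ fun j =>
      c / (ModularForm.discriminant z * (j - kleinJ z)) *
        ((1728 + 6 * (j - kleinJ z)) * E₄ z * phiTildeNeg2 z - 6 * (j - kleinJ z) * phiTilde2 z))).cast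
      (by norm_num)
  have key : (fun τ => kernelPlus24 τ z) = phiNeg2 * a₁ + phi0 * a₂ + phi2 * a₃ := by
    funext τ
    simp only [kernelPlus24, ha₁, ha₂, ha₃, hc, Pi.add_apply, Pi.mul_apply]
    ring
  rw [key]
  exact isAnnPlus_three h₁ h₂ h₃

/-- **Theorem 4.1 (2) for `𝒦₋^{(24)}` in `τ`**: `|₁₂(T − I)² = 0` and `|₁₂(S − I) = 0`.
[cite: CohnEtAl2019, §4.4 Theorem 4.1 (2)] -/
theorem isAnnMinus_kernelMinus24 (z : ℍ) : IsAnnMinus 12 fun τ => kernelMinus24 τ z := by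
  set c : ℂ := 1 / (2 * 1728 * (π : ℂ)) with hc
  set a₁ : ℍ → ℂ := ModularForm.discriminant * fun τ =>
    c / (ModularForm.discriminant z * (kleinJ τ - kleinJ z)) *
      (-2 * 1728 * f2fun z * psiTilde0 z - 2 * 1728 * (kleinJ τ - kleinJ z) * psiTilde2 z) with ha₁
  set a₂ : ℍ → ℂ := E10fun * fun τ => c / (ModularForm.discriminant z * (kleinJ τ - kleinJ z)) *
    ((kleinJ τ + 2 * (kleinJ τ - kleinJ z)) * psiTilde2 z - fNeg2fun z * psiTilde4 z) with ha₂
  set a₃ : ℍ → ℂ := E8fun * fun τ => c / (ModularForm.discriminant z * (kleinJ τ - kleinJ z)) *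
    ((1728 - 2 * (kleinJ τ - kleinJ z) - kleinJ τ) * psiTilde2 z + fNeg2fun z * psiTilde4 z) with ha₃
  have h₁ : IsLevelOneInvariant 12 a₁ :=
    (isLevelOneInvariant_discriminant.mul (isLevelOneInvariant_comp_kleinJ fun j =>
      c / (ModularForm.discriminant z * (j - kleinJ z)) *
        (-2 * 1728 * f2fun z * psiTilde0 z - 2 * 1728 * (j - kleinJ z) * psiTilde2 z))).cast (by norm_num)
  have h₂ : IsLevelOneInvariant (12 - 2) a₂ :=
    (isLevelOneInvariant_E10.mul (isLevelOneInvariant_comp_kleinJ fun j =>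
      c / (ModularForm.discriminant z * (j - kleinJ z)) *
        ((j + 2 * (j - kleinJ z)) * psiTilde2 z - fNeg2fun z * psiTilde4 z))).cast (by norm_num)
  have h₃ : IsLevelOneInvariant (12 - 4) a₃ :=
    (isLevelOneInvariant_E8.mul (isLevelOneInvariant_comp_kleinJ fun j =>
      c / (ModularForm.discriminant z * (j - kleinJ z)) *
        ((1728 - 2 * (j - kleinJ z) - j) * psiTilde2 z + fNeg2fun z * psiTilde4 z))).cast (by norm_num)
  have key : (fun τ => kernelMinus24 τ z) = a₁ + psi2 * a₂ + psi4 * a₃ := by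
    funext τ
    simp only [kernelMinus24, ha₁, ha₂, ha₃, hc, Pi.add_apply, Pi.mul_apply]
    ring
  rw [key]
  exact isAnnMinus_three h₁ h₂ h₃

/-- **Proposition 4.8 for `𝒦₊^{(24)}` in `z`**: `z ↦ 𝒦₊^{(24)}(τ,z)` solves (4.9) in weight
`2 − 12 = −10`. [cite: CohnEtAl2019, §4.4 Proposition 4.8] -/
theorem isAnnPlusDual_kernelPlus24 (τ : ℍ) : IsAnnPlusDual (-10) fun z => kernelPlus24 τ z := by
  set c : ℂ := (π : ℂ) ^ 2 / (36 * 1728 * I) with hc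
  -- `φ̃₋₂(z)`: `E₄/Δ`, weight `−8`
  set b₁ : ℍ → ℂ := (⇑E₄ * ModularForm.discriminant⁻¹) * fun z => c / (kleinJ τ - kleinJ z) *
    (phiNeg2 τ * E14fun τ * (6 * (kleinJ τ - kleinJ z)) +
      phi0 τ * ModularForm.discriminant τ * ((-12 * kleinJ τ + 5 * 1728) * (kleinJ τ - kleinJ z)) +
      phi2 τ * E10fun τ * (1728 + 6 * (kleinJ τ - kleinJ z))) with hb₁
  -- `φ̃₀(z)`: `E₁₄/Δ²`, weight `−10`
  set b₂ : ℍ → ℂ := (f2fun * ModularForm.discriminant⁻¹) * fun z => c / (kleinJ τ - kleinJ z) *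
    (phi0 τ * ModularForm.discriminant τ * (-(2 * 1728))) with hb₂
  -- `φ̃₂(z)`: `1/Δ`, weight `−12`
  set b₃ : ℍ → ℂ := ModularForm.discriminant⁻¹ * fun z => c / (kleinJ τ - kleinJ z) *
    (phiNeg2 τ * E14fun τ * (1728 - 6 * (kleinJ τ - kleinJ z)) +
      phi0 τ * ModularForm.discriminant τ * ((12 * kleinJ τ - 7 * 1728) * (kleinJ τ - kleinJ z)) +
      phi2 τ * E10fun τ * (-(6 * (kleinJ τ - kleinJ z)))) with hb₃
  have h₁ : IsLevelOneInvariant (-10 + 2) b₁ :=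
    ((isLevelOneInvariant_E₄.mul isLevelOneInvariant_discriminant_inv).mul
      (isLevelOneInvariant_comp_kleinJ fun j => c / (kleinJ τ - j) *
        (phiNeg2 τ * E14fun τ * (6 * (kleinJ τ - j)) +
          phi0 τ * ModularForm.discriminant τ * ((-12 * kleinJ τ + 5 * 1728) * (kleinJ τ - j)) +
          phi2 τ * E10fun τ * (1728 + 6 * (kleinJ τ - j))))).cast (by norm_num)
  have h₂ : IsLevelOneInvariant (-10) b₂ :=
    ((isLevelOneInvariant_f2.mul isLevelOneInvariant_discriminant_inv).mul
      (isLevelOneInvariant_comp_kleinJ fun j => c / (kleinJ τ - j) *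
        (phi0 τ * ModularForm.discriminant τ * (-(2 * 1728))))).cast (by norm_num)
  have h₃ : IsLevelOneInvariant (-10 - 2) b₃ :=
    (isLevelOneInvariant_discriminant_inv.mul (isLevelOneInvariant_comp_kleinJ fun j => c / (kleinJ τ - j) *
      (phiNeg2 τ * E14fun τ * (1728 - 6 * (kleinJ τ - j)) +
        phi0 τ * ModularForm.discriminant τ * ((12 * kleinJ τ - 7 * 1728) * (kleinJ τ - j)) +
        phi2 τ * E10fun τ * (-(6 * (kleinJ τ - j)))))).cast (by norm_num)
  have key : (fun z => kernelPlus24 τ z) = phiTildeNeg2 * b₁ + phiTilde0 * b₂ + phiTilde2 * b₃ := by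
    funext z
    have hΔ : ModularForm.discriminant z ≠ 0 := ModularForm.discriminant_ne_zero z
    simp only [kernelPlus24, hb₁, hb₂, hb₃, hc, Pi.add_apply, Pi.mul_apply, Pi.inv_apply]
    field_simp
    ring
  rw [key]
  exact isAnnPlusDual_three h₁ h₂ h₃

/-- **Proposition 4.8 for `𝒦₋^{(24)}` in `z`**: `z ↦ 𝒦₋^{(24)}(τ,z)` solves (4.11) in weight `−10`.
[cite: CohnEtAl2019, §4.4 Proposition 4.8] -/
theorem isAnnMinusDual_kernelMinus24 (τ : ℍ) : IsAnnMinusDual (-10) fun z => kernelMinus24 τ z := by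
  set c : ℂ := 1 / (2 * 1728 * (π : ℂ)) with hc
  -- `ψ̃₀(z)`: `E₁₄/Δ²`, weight `−10`
  set b₁ : ℍ → ℂ := (f2fun * ModularForm.discriminant⁻¹) * fun z => c / (kleinJ τ - kleinJ z) *
    (ModularForm.discriminant τ * (-2 * 1728)) with hb₁
  -- `ψ̃₂(z)`: `1/Δ`, weight `−12`
  set b₂ : ℍ → ℂ := ModularForm.discriminant⁻¹ * fun z => c / (kleinJ τ - kleinJ z) *
    (ModularForm.discriminant τ * (-2 * 1728 * (kleinJ τ - kleinJ z)) +
      psi2 τ * E10fun τ * (kleinJ τ + 2 * (kleinJ τ - kleinJ z)) +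
      psi4 τ * E8fun τ * (1728 - 2 * (kleinJ τ - kleinJ z) - kleinJ τ)) with hb₂
  -- `ψ̃₄(z)`: `E₁₀/Δ²`, weight `−14`
  set b₃ : ℍ → ℂ := (fNeg2fun * ModularForm.discriminant⁻¹) * fun z => c / (kleinJ τ - kleinJ z) *
    (-(psi2 τ * E10fun τ) + psi4 τ * E8fun τ) with hb₃
  have h₁ : IsLevelOneInvariant (-10) b₁ :=
    ((isLevelOneInvariant_f2.mul isLevelOneInvariant_discriminant_inv).mul
      (isLevelOneInvariant_comp_kleinJ fun j => c / (kleinJ τ - j) *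
        (ModularForm.discriminant τ * (-2 * 1728)))).cast (by norm_num)
  have h₂ : IsLevelOneInvariant (-10 - 2) b₂ :=
    (isLevelOneInvariant_discriminant_inv.mul (isLevelOneInvariant_comp_kleinJ fun j =>
      c / (kleinJ τ - j) *
        (ModularForm.discriminant τ * (-2 * 1728 * (kleinJ τ - j)) +
          psi2 τ * E10fun τ * (kleinJ τ + 2 * (kleinJ τ - j)) +
          psi4 τ * E8fun τ * (1728 - 2 * (kleinJ τ - j) - kleinJ τ)))).cast (by norm_num)
  have h₃ : IsLevelOneInvariant (-10 - 4) b₃ :=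
    ((isLevelOneInvariant_fNeg2.mul isLevelOneInvariant_discriminant_inv).mul
      (isLevelOneInvariant_comp_kleinJ fun j => c / (kleinJ τ - j) *
        (-(psi2 τ * E10fun τ) + psi4 τ * E8fun τ))).cast (by norm_num)
  have key : (fun z => kernelMinus24 τ z) = psiTilde0 * b₁ + psiTilde2 * b₂ + psiTilde4 * b₃ := by
    funext z
    have hΔ : ModularForm.discriminant z ≠ 0 := ModularForm.discriminant_ne_zero z
    simp only [kernelMinus24, hb₁, hb₂, hb₃, hc, f2fun, fNeg2fun, Pi.add_apply, Pi.mul_apply, Pi.inv_apply]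
    field_simp
    ring
  rw [key]
  exact isAnnMinusDual_three h₁ h₂ h₃

end Literature.NumberTheory.ModularForms
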